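import Mathlib
import Summits.ResolutionOfSingularities.ResolutionOfSingularities.Theorems.HomologicalConductorPersistencePointedCeilingCurvette
import Literature.AlgebraicGeometry.Resolution.ExceptionalCurvePoints
import Literature.AlgebraicGeometry.Resolution.Lipman1969NegativeDefinite
import HarnessLib

/-!
# [OURS · L1 w44b] K-PCC sheaf half, FILE 5: the pointed ceiling for a RESOLUTION of a normal surface germ,
# with the exceptional curves as index set — binders `hneg` and `hFE` discharged from Lipman 1969 §14

Rung S-2 `HomologicalConductor.PersistenceSurface` (stmt-ResolutionOfSingularities-19970), route
`ResolutionOfSingularities/HomologicalConductor`, chain W4.4b (cell res-hironaka), WAVE-3 row «stub-3 → K-PCC SHEAF HALF»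
(lead memo K-PCC, res-L1-w44b-lead-1 g4, Thm 2.3). `[OURS · L1 w44b]`; NOT a statement of the manuscript under review;
AI-written, weaker than expert review. Over FILE 4b `…PointedCeilingCurvette` (K-PCC Thm 2.3 for curvettes with explicit
binders `hneg`, `hFE`), this file:

* consumes the two NAMED FACTS of Lipman 1969 §14 (p. 224) typed in
  `Literature/AlgebraicGeometry/Resolution/Lipman1969NegativeDefinite.lean` (`Lipman1969_14_1`: the intersection matrix of
  the exceptional curves of a desingularization of a two-dimensional normal local ring is negative definite — du Val's
  lemma; `Lipman1969_14_closedPoint`: every closed point of such a desingularization has codimension two);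
* `hneg_of_Lipman1969_14_1` — the lattice shape `∀ N, 0 ≤ Σ_i N_i (Σ_j N_j M j i) → N = 0` used by lead-1's
  `…PersistencePointedCyclesDefinite`; `mem_excCurvePoints_of_coheight_le_one` — from `Lipman1969_14_closedPoint`: a
  closed-fibre point of codimension `≤ 1` is an integral exceptional curve (the binder `hFE`);
* **`least_sub_greatest_le_ord_of_mem_cohomologyAnnihilatorOfDegree_three_of_isResolution`** — K-PCC Thm 2.3, RESOLUTION
  FORM: `T` a normal noetherian local domain of dimension `2`, `π : X → Spec T` a resolution (`IsResolution`), `F` the finite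
  set of ALL integral exceptional curves, a curvette `γ` at `C_t`; granting the two named facts, every non-zero `x ∈ ca³(T)` has
  `ord_{E_i}(x) ≥ Z₀ i − A₀ i` for `Z₀ = Z⁽ᵗ⁾`, `A₀ = A⁽ᵗ⁾` (hypotheses `hZ₀`, `hA₀` as in the lattice half).

References: J. Lipman, *Rational singularities …*, Publ. Math. IHÉS 36 (1969), §14, Lemma (14.1) and the remark preceding it
(p. 224) [`Lipman1969`]; A. Grothendieck, EGA III (4.4.8) [`EGAIII`].
-/

set_option linter.dupNamespace false
set_option autoImplicit false

noncomputable section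

open CategoryTheory AlgebraicGeometry TopologicalSpace IsLocalRing Opposite Order
open Literature.AlgebraicGeometry.Motives Literature.AlgebraicGeometry.Motives.RatFn
open Literature.AlgebraicGeometry.Resolution Literature.RingTheory.CohomologyAnnihilator
open Summit.ResolutionOfSingularities.ResolutionOfSingularities.Theorems.NoZeno.SandwichCluster

universe u

namespace Summit.ResolutionOfSingularities.ResolutionOfSingularities.Theorems.HomologicalConductor.PersistencePointedCeiling

/-! ## The binders `hneg` and `hFE` from the named facts -/

variable {X : Scheme.{u}} [IsIntegral X] [IsLocallyNoetherian X] {T : Type u} [CommRing T] [IsNoetherianRing T]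
  [IsLocalRing T] [IsDomain T] [IsIntegrallyClosed T] (π : X ⟶ Spec (.of T))

/-- **`hneg` from Lipman (14.1)**: the negative-definiteness hypothesis of the lattice half
(`…PersistencePointedCyclesDefinite`: `0 ≤ Σ_i N_i (N·C_i) ⇒ N = 0`) for the exceptional curves of a resolution of a
two-dimensional normal germ. [cite: Lipman1969, Lemma (14.1) (p. 224)] -/
theorem hneg_of_Lipman1969_14_1 (h141 : Lipman1969_14_1.{u}) (h2 : ringKrullDim T = 2) (hπ : IsResolution π)
    (F : Finset X) (hFexc : ∀ η ∈ F, η ∈ excCurvePoints π) (hc : ∀ η ∈ F, IsEffectiveCartier (primeDivisorIdeal η))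
    (N : {η // η ∈ F} → ℤ)
    (hN : 0 ≤ ∑ i, N i * ∑ j, N j *
      excCurveDegree π (CartierDivisor.ofIsEffectiveCartier (primeDivisorIdeal (j : X)) (hc j j.2)) i) : N = 0 := by
  by_contra hne
  have hlt := h141 T h2 X π hπ F hFexc hc N hne
  have e : ∑ i, N i * ∑ j, N j *
      excCurveDegree π (CartierDivisor.ofIsEffectiveCartier (primeDivisorIdeal (j : X)) (hc j j.2)) i =
      ∑ i, ∑ j, N i * N j *
        excCurveDegree π (CartierDivisor.ofIsEffectiveCartier (primeDivisorIdeal (j : X)) (hc j j.2)) i := by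
    refine Finset.sum_congr rfl fun i _ => ?_
    rw [Finset.mul_sum]
    refine Finset.sum_congr rfl fun j _ => ?_
    ring
  rw [e] at hN
  exact absurd hlt (not_lt.mpr hN)

omit [IsLocallyNoetherian X] [IsNoetherianRing T] [IsIntegrallyClosed T] in
/-- A point of the closed fibre is not the generic point of `X` (`dim T = 2`, `π` dominant). [folklore] -/
theorem ne_genericPoint_of_base_eq_closedPoint (h2 : ringKrullDim T = 2) [IsDominant π] {η : X}
    (hη : π.base η = closedPoint T) : η ≠ genericPoint X := by
  intro h
  subst h
  have hξ : π.base (genericPoint X) = genericPoint (Spec (.of T)) := RatFn.genericPoint_eq_of_isDominant π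
  rw [hξ, genericPoint_eq_bot_of_affine] at hη
  have hm : maximalIdeal T = ⊥ := by
    have := congrArg PrimeSpectrum.asIdeal hη
    change (⊥ : Ideal T) = (closedPoint T).asIdeal at this
    exact this.symm
  have h0 := IsLocalRing.maximalIdeal_height_eq_ringKrullDim (R := T)
  rw [hm, Ideal.height_bot, h2] at h0
  exact absurd h0 (by decide)

omit [IsLocallyNoetherian X] in
/-- **`hFE` from Lipman §14**: granting `Lipman1969_14_closedPoint`, a point of the closed fibre of a resolution of a
two-dimensional normal germ of codimension `≤ 1` is (the generic point of) an integral exceptional curve — it is not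
closed (closed points have codimension `2`) and it is a maximal point of the fibre (a proper generisation inside the fibre
would have codimension `0`, i.e. be the generic point of `X`). [cite: Lipman1969, Section 14 (p. 224)] -/
theorem mem_excCurvePoints_of_coheight_le_one [IsLocallyNoetherian X] (h14 : Lipman1969_14_closedPoint.{u})
    (h2 : ringKrullDim T = 2) (hπ : IsResolution π) {ζ : X} (hζ : π.base ζ = closedPoint T) (hc : coheight ζ ≤ 1) :
    ζ ∈ excCurvePoints π := by
  haveI : IsDominant π := hπ.isBirational.isDominant
  rw [hπ.mem_excCurvePoints_iff h2]
  refine ⟨(mem_excPoints_iff π ζ).2 ⟨hζ, fun η' hη' hsp => ?_⟩, fun hcl => ?_⟩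
  · -- a generisation `η' ⤳ ζ` inside the fibre equals `ζ`
    have hη'0 : coheight η' ≠ 0 := by
      intro h0
      exact ne_genericPoint_of_base_eq_closedPoint π h2 hη' (eq_genericPoint_of_coheight_eq_zero h0)
    refine eq_of_specializes_of_coheight_le hsp (fun h => ?_) ?_
    · rw [h] at hc; exact absurd hc (by decide)
    · exact hc.trans (Order.one_le_iff_ne_zero.mpr hη'0)
  · have h := h14 T h2 X π hπ ζ hcl
    rw [h] at hc
    exact absurd hc (by decide)

/-! ## K-PCC Thm 2.3, resolution form -/

/-- **THE POINTED CEILING FOR A RESOLUTION OF A NORMAL SURFACE GERM (K-PCC Thm 2.3).** `T` a normal noetherian local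
domain of Krull dimension `2`, `π : X → Spec T` a resolution (`X` locally noetherian), `F` the finite set of ALL integral
exceptional curves (`↑F = excCurvePoints π`), `M j i = ([E_j]·E_i)`, `γ` a codimension-one point off the closed fibre with
`([Γ]·E_i) = δ_it` (a curvette at `C_t`), `Z₀ ≤` every effective cycle pointed anti-nef at `t` and `A₀ ≥` every effective
cycle almost nef at `t` (e.g. `Z⁽ᵗ⁾`, `A⁽ᵗ⁾`). Granting Lipman (14.1) and the codimension of closed points (§14), every
non-zero `x ∈ ca³(T)` satisfies **`Z₀ i − A₀ i ≤ ord_{E_i}(x)`** for every `i` — `ca³(T) ⊆ I(Z⁽ᵗ⁾ − A⁽ᵗ⁾)`.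
[cite: Lipman1969, Lemma (14.1) and Section 12 (pp. 220–224)] [cite: IyengarTakahashi2014, Remark 2.13] -/
theorem least_sub_greatest_le_ord_of_mem_cohomologyAnnihilatorOfDegree_three_of_isResolution [DecidableEq X]
    (h141 : Lipman1969_14_1.{u}) (h14 : Lipman1969_14_closedPoint.{u}) (h2 : ringKrullDim T = 2) (hπ : IsResolution π)
    (F : Finset X) (hFeq : (F : Set X) = excCurvePoints π) (t : {η // η ∈ F})
    {γ : X} (hγ : coheight γ = 1) (hγE : π.base γ ≠ closedPoint T)
    (hΓ : ∀ i : {η // η ∈ F}, excCurveDegree π (CartierDivisor.ofIsEffectiveCartier (primeDivisorIdeal γ)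
      (isEffectiveCartier_primeDivisorIdeal_of_isRegular hπ.isRegular hγ)) i = (if i = t then 1 else 0))
    (Z₀ A₀ : {η // η ∈ F} → ℕ)
    (hZ₀ : ∀ Z : {η // η ∈ F} → ℕ, (∀ i : {η // η ∈ F}, ∑ j, (Z j : ℤ) *
        excCurveDegree π (CartierDivisor.ofIsEffectiveCartier (primeDivisorIdeal (j : X))
          (isEffectiveCartier_primeDivisorIdeal_of_isRegular hπ.isRegular
            (hπ.coheight_eq_one_of_mem_excCurvePoints h2 (hFeq ▸ j.2)))) i ≤
        -(if i = t then 1 else 0)) → Z₀ ≤ Z)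
    (hA₀ : ∀ A : {η // η ∈ F} → ℕ, (∀ i : {η // η ∈ F}, -(if i = t then (1 : ℤ) else 0) ≤ ∑ j, (A j : ℤ) *
        excCurveDegree π (CartierDivisor.ofIsEffectiveCartier (primeDivisorIdeal (j : X))
          (isEffectiveCartier_primeDivisorIdeal_of_isRegular hπ.isRegular
            (hπ.coheight_eq_one_of_mem_excCurvePoints h2 (hFeq ▸ j.2)))) i) → A ≤ A₀)
    {x : T} (hx : x ∈ cohomologyAnnihilatorOfDegree T 3) (hx0 : x ≠ 0) (i : {η // η ∈ F}) :
    (Z₀ i : ℤ) - A₀ i ≤ Scheme.ord (baseToFunctionField π x) i := by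
  haveI : IsProper π := hπ.isProper
  have hFexc : ∀ η ∈ F, η ∈ excCurvePoints π := fun η hη => hFeq ▸ (hη : η ∈ (F : Set X))
  have hF : ∀ η ∈ F, coheight η = 1 := fun η hη => hπ.coheight_eq_one_of_mem_excCurvePoints h2 (hFexc η hη)
  have hFE : ∀ ζ : X, π ζ = closedPoint T → coheight ζ ≤ 1 → ζ ∈ F := by
    intro ζ hζ hc
    have h := mem_excCurvePoints_of_coheight_le_one π h14 h2 hπ hζ hc
    rw [← hFeq] at h
    exact h
  exact least_sub_greatest_le_ord_of_mem_cohomologyAnnihilatorOfDegree_three π hπ.isRegular hπ.isBirational h2 F hF hFexc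
    hFE (hneg_of_Lipman1969_14_1 π h141 h2 hπ F hFexc fun η hη =>
      isEffectiveCartier_primeDivisorIdeal_of_isRegular hπ.isRegular (hF η hη)) t hγ hγE hΓ Z₀ A₀ hZ₀ hA₀ hx hx0 i

end Summit.ResolutionOfSingularities.ResolutionOfSingularities.Theorems.HomologicalConductor.PersistencePointedCeiling

end
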